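import Mathlib.Analysis.InnerProductSpace.Adjoint
import Mathlib.Analysis.InnerProductSpace.Projection.Basic
import HarnessLib

/-!
# NE7AdjointGramCoercivity — (α) FROM THE GRAM FORM OF THE ADJOINT: a lower bound `λ‖μ‖² ≤ ‖S†μ‖²` (= `⟪μ, SS†μ⟫`) gives `λ`-coercivity of
# `S` on `(ker S)ᗮ` with the SAME `λ`; an upper bound `‖S†μ‖² ≤ Λ²‖μ‖²` gives `‖S v‖ ≤ Λ‖v‖` (finite-dimensional real inner-product spaces)

Cell `pub-balaban`, rung (B)+1 sub-cell t4, lineage `b2b-balaban-t4-ne7-p1`, generation 62 (CRUX PROVER NE7 #1, ruling e34b3e0c (2)); hunt (h7)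
«ENERGY ROAD», memo v2 §6 (`t4/b2b-balaban-t4-ne7-p1-g62/HUNT-H7-ENERGY-ROAD-v2.md`); companion of `Support/NE7TensionKernelCoercivity` (§5 exact-current form:
hypotheses `λ‖v‖² ≤ ‖Sv‖²` on `(ker S)ᗮ` and `‖Sv‖ ≤ Λ‖v‖`) and of `Support/NE7LineSumGramBounds` (the flat symbol of the straight block-line sum:
`M(M²+2)∕3 ≤ ‖S†μ‖²∕‖μ‖² ≤ M³` per line, unnormalised).  THIS file is the abstract link: the two hypotheses of §5 follow from TWO-SIDED bounds on the
Gram quadratic form `μ ↦ ‖S†μ‖²` of the ADJOINT (`S†μ` = the longitudinal linear interpolation `Wad` for the straight average,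
`NE3StraightAverageAdjoint.sum_inner_lineSum_eq_sum_inner_Wad`): `mem_range_adjoint_of_mem_ker_orthogonal` (`(ker S)ᗮ ≤ range S†` in finite dimensions),
**`coercive_of_adjoint_lower_bound`**, **`opNorm_le_of_adjoint_upper_bound`**.  With the flat symbol: `λ = M(M²+2)∕3·(normalisation)`, `Λ² = M³·(same)`,
`Λ²∕λ ≤ 3`.  [folklore] linear algebra (Cauchy–Schwarz; no spectral theorem).
HONEST FRAMING (page 1): nothing about Bałaban's minimisers; the identification of `S` with the straight linearised k-fold average on the skew torus 1-forms
and the curved small-field case are NOT done here; NE7, NE3 NOT PRINTED in [Balaban1984PropagatorsI]–[Balaban1989LargeFieldII] and NOT PROVED; FIXED FINITE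
torus, rung (B)+1; continuum YM on T⁴ ⇐ BetaPertH ∧ nine spine estimates (0/9 proved); BetaPertH ⇐ (D1) ∧ (D4) ∧ CAP+tail; G-an2-4 gates asym, D1 and
NE2/3/4; NOT infinite volume, NOT mass gap, NOT Clay.  0 def, 0 sorry.
-/

set_option autoImplicit false

open scoped InnerProductSpace

namespace Summit.QuantumFields.BalabanUV.T4Continuum.NE7AdjointGramCoercivity

/-! ## (α) FROM THE GRAM FORM OF THE ADJOINT: a LOWER bound `λ‖μ‖² ≤ ‖S†μ‖²` (= `⟪μ, SS†μ⟫`, the Gram quadratic form whose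
flat symbol is two-sided with `c = 1∕3`) gives `λ`-coercivity of `S` on `(ker S)ᗮ` with the SAME `λ`; an upper bound gives the operator norm -/

section Gram

variable {E F : Type*} [NormedAddCommGroup E] [InnerProductSpace ℝ E] [NormedAddCommGroup F] [InnerProductSpace ℝ F]
  [FiniteDimensional ℝ E] [FiniteDimensional ℝ F]

/-- In finite dimensions `(ker S)ᗮ ≤ range S†`: a vector orthogonal to `ker S` is an adjoint image. [folklore] -/
theorem mem_range_adjoint_of_mem_ker_orthogonal (S : E →L[ℝ] F) {v : E} (hv : v ∈ (LinearMap.ker (S : E →ₗ[ℝ] F))ᗮ) :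
    ∃ μ : F, ContinuousLinearMap.adjoint S μ = v := by
  haveI : CompleteSpace E := FiniteDimensional.complete ℝ E
  haveI : CompleteSpace F := FiniteDimensional.complete ℝ F
  set K' : Submodule ℝ E := LinearMap.range ((ContinuousLinearMap.adjoint S : F →L[ℝ] E) : F →ₗ[ℝ] E) with hK'
  haveI : CompleteSpace K' := FiniteDimensional.complete ℝ K'
  haveI : K'.HasOrthogonalProjection := Submodule.HasOrthogonalProjection.ofCompleteSpace K'
  obtain ⟨v₁, hv₁, v₂, hv₂, hvv⟩ := K'.exists_add_mem_mem_orthogonal v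
  -- `v₂ ∈ K'ᗮ` lies in `ker S`
  have hSv₂ : S v₂ = 0 := by
    have h0 : ∀ μ : F, ⟪S v₂, μ⟫_ℝ = 0 := fun μ => by
      rw [← ContinuousLinearMap.adjoint_inner_right]
      exact (Submodule.mem_orthogonal' K' v₂).mp hv₂ _ (LinearMap.mem_range_self _ μ)
    simpa using h0 (S v₂)
  -- hence `⟪v, v₂⟫ = 0`, and `v₂ = 0`
  have hvv₂ : ⟪v, v₂⟫_ℝ = 0 := (Submodule.mem_orthogonal' _ v).mp hv v₂ hSv₂
  have h12 : ⟪v₁, v₂⟫_ℝ = 0 := Submodule.inner_right_of_mem_orthogonal hv₁ hv₂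
  have hv₂0 : v₂ = 0 := by
    have h : ⟪v₂, v₂⟫_ℝ = 0 := by
      have := hvv₂; rw [hvv, inner_add_left, h12, zero_add] at this; exact this
    exact inner_self_eq_zero.mp h
  rw [hv₂0, add_zero] at hvv
  obtain ⟨μ, hμ⟩ := LinearMap.mem_range.mp hv₁
  exact ⟨μ, by rw [hvv]; exact hμ⟩

/-- **(α) FROM A LOWER GRAM BOUND ON THE ADJOINT**: if `λ·‖μ‖² ≤ ‖S†μ‖²` for all `μ` (`λ > 0`; `‖S†μ‖² = ⟪μ, SS†μ⟫` is the Gram quadratic form —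
for the straight block-line average its flat symbol is `≥ M(M²+2)∕3` per line, `NE7` memo v2 §(43h)), then `λ·‖v‖² ≤ ‖S v‖²` for every `v ∈ (ker S)ᗮ`,
with the SAME `λ` (`v = S†μ`; `‖v‖² = ⟪μ, S v⟫ ≤ ‖μ‖‖Sv‖`, `‖μ‖ ≤ ‖v‖∕√λ`). [folklore] -/
theorem coercive_of_adjoint_lower_bound (S : E →L[ℝ] F) {lam : ℝ} (hlam : 0 < lam)
    (hlow : ∀ μ : F, lam * ‖μ‖ ^ 2 ≤ ‖ContinuousLinearMap.adjoint S μ‖ ^ 2) :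
    ∀ v : E, v ∈ (LinearMap.ker (S : E →ₗ[ℝ] F))ᗮ → lam * ‖v‖ ^ 2 ≤ ‖S v‖ ^ 2 := by
  haveI : CompleteSpace E := FiniteDimensional.complete ℝ E
  haveI : CompleteSpace F := FiniteDimensional.complete ℝ F
  intro v hv
  obtain ⟨μ, hμ⟩ := mem_range_adjoint_of_mem_ker_orthogonal S hv
  -- `‖v‖² = ⟪μ, S v⟫ ≤ ‖μ‖·‖S v‖`
  have h1 : ‖v‖ ^ 2 ≤ ‖μ‖ * ‖S v‖ := by
    have e : ‖v‖ ^ 2 = ⟪μ, S v⟫_ℝ := by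
      rw [← real_inner_self_eq_norm_sq, ← hμ, ContinuousLinearMap.adjoint_inner_left]
    rw [e]
    exact (real_inner_le_norm _ _)
  -- `λ‖μ‖² ≤ ‖v‖²`
  have h2 : lam * ‖μ‖ ^ 2 ≤ ‖v‖ ^ 2 := by rw [← hμ]; exact hlow μ
  -- conclude: λ‖v‖⁴ ≤ λ‖μ‖²‖Sv‖² ≤ ‖v‖²‖Sv‖²
  by_cases hv0 : v = 0
  · subst hv0; simp
  · have hvpos : 0 < ‖v‖ ^ 2 := by positivity
    have h3 : ‖v‖ ^ 4 ≤ ‖μ‖ ^ 2 * ‖S v‖ ^ 2 := by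
      have := mul_self_le_mul_self (by positivity) h1
      nlinarith [this]
    have h4 : lam * ‖v‖ ^ 4 ≤ ‖v‖ ^ 2 * ‖S v‖ ^ 2 := by
      nlinarith [h2, h3, sq_nonneg ‖S v‖, mul_le_mul_of_nonneg_right h2 (sq_nonneg ‖S v‖)]
    nlinarith [h4, hvpos]

/-- **THE OPERATOR NORM FROM AN UPPER GRAM BOUND ON THE ADJOINT**: `‖S†μ‖² ≤ Λ²·‖μ‖²` for all `μ` (`Λ ≥ 0`) gives `‖S v‖ ≤ Λ·‖v‖` for all `v`
(`‖Sv‖² = ⟪S†Sv, v⟫ ≤ ‖S†(Sv)‖‖v‖ ≤ Λ‖Sv‖‖v‖`). [folklore] -/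
theorem opNorm_le_of_adjoint_upper_bound (S : E →L[ℝ] F) {Lam : ℝ} (hLam : 0 ≤ Lam)
    (hup : ∀ μ : F, ‖ContinuousLinearMap.adjoint S μ‖ ^ 2 ≤ Lam ^ 2 * ‖μ‖ ^ 2) : ∀ v : E, ‖S v‖ ≤ Lam * ‖v‖ := by
  haveI : CompleteSpace E := FiniteDimensional.complete ℝ E
  haveI : CompleteSpace F := FiniteDimensional.complete ℝ F
  intro v
  have hup' : ∀ μ : F, ‖ContinuousLinearMap.adjoint S μ‖ ≤ Lam * ‖μ‖ := fun μ => by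
    have h := hup μ
    rw [← mul_pow] at h
    exact (pow_le_pow_iff_left₀ (norm_nonneg _) (by positivity) two_ne_zero).mp h
  have h1 : ‖S v‖ ^ 2 ≤ Lam * ‖S v‖ * ‖v‖ := by
    have e : ‖S v‖ ^ 2 = ⟪ContinuousLinearMap.adjoint S (S v), v⟫_ℝ := by
      rw [← real_inner_self_eq_norm_sq, ContinuousLinearMap.adjoint_inner_left]
    rw [e]
    refine (real_inner_le_norm _ _).trans ?_
    exact mul_le_mul_of_nonneg_right (hup' _) (norm_nonneg _)
  by_cases h0 : ‖S v‖ = 0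
  · rw [h0]; positivity
  · have hpos : 0 < ‖S v‖ := lt_of_le_of_ne (norm_nonneg _) (Ne.symm h0)
    nlinarith [h1, hpos]

end Gram

end Summit.QuantumFields.BalabanUV.T4Continuum.NE7AdjointGramCoercivity
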